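import Summits.RiemannHypothesis.RiemannHypothesis.Theorems.UniversalFactorNarrowKernelNoGoEnergyUpperKernel
import Summits.RiemannHypothesis.RiemannHypothesis.Theorems.UniversalFactorNarrowKernelNoGoEnergyUpperMajorant

/-!
# RiemannHypothesis / UniversalFactor — `NarrowKernelNoGo`, stub K1b (energy upper bound), part 4:
the first-approximation error in mean square

Route `RiemannHypothesis/UniversalFactor`, crux `NarrowKernelNoGo` (stmt-RiemannHypothesis-2576), line
`Sketch`, stub `stub_narrowEnergyUpper`. With a GLOBAL length `P = ⌊√(T/4π)⌋` on `[T, 2T+1]`, the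
filtered error term `R(t) = ∫ k(u) E(t+u) w(t) Re e_P(t+u) du` satisfies `∫_T^{2T+1} R² ≤ C T`:

* `UniversalFactor.narrowUpper_weighted_cs` — Cauchy–Schwarz against the kernel majorant `K`:
  `R(t)² ≤ (∫K)(∫ K(u) |e_P(t+u)|² du)`;
* `UniversalFactor.narrowUpper_err_integrable_prod` — `K(u)|e_P(t+u)|²` is integrable on
  `[T, 2T+1] × ℝ` (Tonelli is legitimate);
* `UniversalFactor.narrowUpper_err_inner_le` — for every shift `u`,
  `∫_T^{2T+1} |e_P(t+u)|² dt ≤ C_e T (2+|u|)³`: for `|u| ≤ T/2` this is Titchmarsh's (9.20.7)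
  (`TwistedMoment.integral_norm_sq_hardyZErr_le` on `[T/2, 5T/2+1]`, which is `O(T)` for the length
  `P` attached to `T/2`), for `|u| > T/2` the crude bound `|e_P(s)| ≤ 14(2+|u|)` absorbs `T ≤ 2|u|`;
* `UniversalFactor.narrowUpper_err_meanSquare` — Tonelli: `∫_T^{2T+1} ∫ K |e_P(t+u)|² du dt ≤ C_e M₅ T`.

References: Titchmarsh, *The Theory of the Riemann Zeta-Function* (1986), §9.20 eq. (9.20.7).
-/

noncomputable section

-- D-0017: `Summit.<S>.<S>.…` is the designed namespace of a single-problem summit.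
set_option linter.dupNamespace false

namespace Summit.RiemannHypothesis.RiemannHypothesis.Theorems

open MeasureTheory Set Filter Complex intervalIntegral
open scoped Real Topology
open Literature.NumberTheory.LFunctions

/-! ## Cauchy–Schwarz against a majorant -/

/-- AM–GM route to Cauchy–Schwarz: if `A, B, S ≥ 0` and `2S ≤ λA + B/λ` for every `λ > 0`, then
`S² ≤ AB`. [folklore] -/
theorem UniversalFactor.narrowUpper_sq_le_of_forall {A B S : ℝ} (hA : 0 ≤ A) (hB : 0 ≤ B) (hS : 0 ≤ S)
    (h : ∀ l : ℝ, 0 < l → 2 * S ≤ l * A + B / l) : S ^ 2 ≤ A * B := by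
  by_contra hcon
  rw [not_le] at hcon
  have hS0 : 0 < S := by
    rcases hS.eq_or_lt with h0 | h0
    · rw [← h0] at hcon; nlinarith [mul_nonneg hA hB]
    · exact h0
  rcases hA.eq_or_lt with hA0 | hA0
  · have h1 := h (B / S + 1) (by positivity)
    rw [← hA0, mul_zero, zero_add] at h1
    have h2 : B / (B / S + 1) ≤ S := by
      rw [div_le_iff₀ (by positivity)]
      have : S * (B / S + 1) = B + S := by field_simp
      rw [this]; linarith
    linarith
  · have h1 := h (S / A) (by positivity)
    have e1 : S / A * A = S := div_mul_cancel₀ S hA0.ne'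
    have e2 : B / (S / A) = A * B / S := by field_simp
    rw [e1, e2] at h1
    have h3 : S ≤ A * B / S := by linarith
    rw [le_div_iff₀ hS0] at h3
    nlinarith

/-- **Cauchy–Schwarz against a majorant.** If `|ρ| ≤ K` pointwise and `K`, `K|h|`, `Kh²` are
integrable, then `(∫ ρ h)² ≤ (∫ K)(∫ K h²)` (no integrability of `ρh` is needed: a non-integrable
`ρh` has integral `0`). [folklore] -/
theorem UniversalFactor.narrowUpper_weighted_cs_of {ρ h K : ℝ → ℝ} (hρK : ∀ u, |ρ u| ≤ K u)
    (hK : Integrable K) (hKh : Integrable fun u => K u * |h u|)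
    (hKh2 : Integrable fun u => K u * h u ^ 2) :
    (∫ u, ρ u * h u) ^ 2 ≤ (∫ u, K u) * ∫ u, K u * h u ^ 2 := by
  have hK0 : ∀ u, 0 ≤ K u := fun u => (abs_nonneg _).trans (hρK u)
  set S := ∫ u, K u * |h u| with hS
  have hS0 : 0 ≤ S := integral_nonneg fun u => mul_nonneg (hK0 u) (abs_nonneg _)
  have hA0 : 0 ≤ ∫ u, K u := integral_nonneg hK0
  have hB0 : 0 ≤ ∫ u, K u * h u ^ 2 := integral_nonneg fun u => mul_nonneg (hK0 u) (sq_nonneg _)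
  have h1 : |∫ u, ρ u * h u| ≤ S := by
    refine (MeasureTheory.abs_integral_le_integral_abs).trans ?_
    refine integral_mono_of_nonneg (Eventually.of_forall fun u => abs_nonneg _) hKh
      (Eventually.of_forall fun u => ?_)
    simp only [abs_mul]
    exact mul_le_mul_of_nonneg_right (hρK u) (abs_nonneg _)
  have h2 : S ^ 2 ≤ (∫ u, K u) * ∫ u, K u * h u ^ 2 := by
    refine UniversalFactor.narrowUpper_sq_le_of_forall hA0 hB0 hS0 fun l hl => ?_
    have hpt : ∀ u, 2 * (K u * |h u|) ≤ l * K u + K u * h u ^ 2 / l := by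
      intro u
      have h0 : 0 ≤ K u * (l - |h u|) ^ 2 / l := by have := hK0 u; positivity
      have e : K u * (l - |h u|) ^ 2 / l = l * K u + K u * h u ^ 2 / l - 2 * (K u * |h u|) := by
        field_simp
        rw [← sq_abs (h u)]; ring
      linarith
    calc 2 * S = ∫ u, 2 * (K u * |h u|) := (MeasureTheory.integral_const_mul _ _).symm
      _ ≤ ∫ u, (l * K u + K u * h u ^ 2 / l) :=
          integral_mono (hKh.const_mul 2) ((hK.const_mul l).add (hKh2.div_const l)) hpt
      _ = l * (∫ u, K u) + (∫ u, K u * h u ^ 2) / l := by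
          rw [integral_add (hK.const_mul l) (hKh2.div_const l), MeasureTheory.integral_const_mul,
            MeasureTheory.integral_div]
  calc (∫ u, ρ u * h u) ^ 2 = |∫ u, ρ u * h u| ^ 2 := (sq_abs _).symm
    _ ≤ S ^ 2 := pow_le_pow_left₀ (abs_nonneg _) h1 2
    _ ≤ _ := h2

/-! ## Tonelli for `K(u) |e_P(t+u)|²` -/

/-- The two-variable function `(t, u) ↦ (2+|u|)² e^{-c|u|} ‖e_P(t+u)‖²` is integrable on
`(T₁, T₂] × ℝ` (`e_P` grows at most linearly, the kernel has finite moments). [folklore] -/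
theorem UniversalFactor.narrowUpper_err_integrable_prod {c : ℝ} (hc : 0 < c) (P : ℕ) (T₁ T₂ : ℝ) :
    Integrable (Function.uncurry fun (t u : ℝ) => (2 + |u|) ^ 2 * Real.exp (-(c * |u|)) *
        ‖TwistedMoment.hardyZErr P (t + u)‖ ^ 2)
      ((volume.restrict (Ioc T₁ T₂)).prod volume) := by
  rw [Function.uncurry_def]
  set M : ℝ := 2 + 2 * max |T₁| |T₂| + 4 * Real.sqrt P with hM
  have hmax : 0 ≤ max |T₁| |T₂| := le_max_of_le_left (abs_nonneg _)
  have hM2 : 2 ≤ M := by have := Real.sqrt_nonneg (P:ℝ); rw [hM]; nlinarith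
  have hG : Integrable (fun u : ℝ => M ^ 2 * ((2 + |u|) ^ 4 * Real.exp (-(c * |u|)))) :=
    (UniversalFactor.narrowUpper_integrable_pow_mul_exp hc 4).const_mul _
  have h1 : Integrable (fun _ : ℝ => (1:ℝ)) (volume.restrict (Ioc T₁ T₂)) := integrable_const _
  have hprod := h1.mul_prod hG
  refine hprod.mono' ?_ ?_
  · have hcont : Continuous fun p : ℝ × ℝ => (2 + |p.2|) ^ 2 * Real.exp (-(c * |p.2|)) *
        ‖TwistedMoment.hardyZErr P (p.1 + p.2)‖ ^ 2 := by
      have he := (UniversalFactor.narrowUpper_continuous_hardyZErr P).comp (continuous_fst.add continuous_snd)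
      exact ((by fun_prop : Continuous fun p : ℝ × ℝ => (2 + |p.2|) ^ 2 * Real.exp (-(c * |p.2|))).mul
        (he.norm.pow 2))
    exact hcont.aestronglyMeasurable
  · have hmeas : MeasurableSet (Ioc T₁ T₂ ×ˢ (univ : Set ℝ)) := measurableSet_Ioc.prod MeasurableSet.univ
    have hre : (volume.restrict (Ioc T₁ T₂)).prod (volume : Measure ℝ) =
        ((volume : Measure ℝ).prod (volume : Measure ℝ)).restrict (Ioc T₁ T₂ ×ˢ univ) := by
      rw [← Measure.prod_restrict, Measure.restrict_univ]
    rw [hre]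
    refine ae_restrict_of_forall_mem hmeas fun p hp => ?_
    have ht : p.1 ∈ Ioc T₁ T₂ := hp.1
    have hpos : 0 ≤ (2 + |p.2|) ^ 2 * Real.exp (-(c * |p.2|)) * ‖TwistedMoment.hardyZErr P (p.1 + p.2)‖ ^ 2 := by
      positivity
    rw [Real.norm_eq_abs, abs_of_nonneg hpos, one_mul]
    have habs : |p.1| ≤ max |T₁| |T₂| := by
      rw [abs_le]; constructor
      · have h1 := neg_abs_le T₁; have h2 := le_max_left |T₁| |T₂|; linarith [ht.1]
      · exact ht.2.trans ((le_abs_self T₂).trans (le_max_right _ _))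
    have he : ‖TwistedMoment.hardyZErr P (p.1 + p.2)‖ ≤ M * (2 + |p.2|) := by
      have h := UniversalFactor.narrowUpper_norm_hardyZErr_le_crude P (p.1 + p.2)
      have h2 : |p.1 + p.2| ≤ |p.1| + |p.2| := abs_add_le _ _
      have h3 : M + 2 * |p.2| ≤ M * (2 + |p.2|) := by nlinarith [abs_nonneg p.2]
      rw [hM] at h3 ⊢; nlinarith [abs_nonneg p.2]
    have he2 : ‖TwistedMoment.hardyZErr P (p.1 + p.2)‖ ^ 2 ≤ (M * (2 + |p.2|)) ^ 2 :=
      pow_le_pow_left₀ (norm_nonneg _) he 2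
    calc (2 + |p.2|) ^ 2 * Real.exp (-(c * |p.2|)) * ‖TwistedMoment.hardyZErr P (p.1 + p.2)‖ ^ 2
        ≤ (2 + |p.2|) ^ 2 * Real.exp (-(c * |p.2|)) * (M * (2 + |p.2|)) ^ 2 := by gcongr
      _ = M ^ 2 * ((2 + |p.2|) ^ 4 * Real.exp (-(c * |p.2|))) := by ring

/-! ## The shifted mean square of `e_P` -/

/-- **The inner integral.** Let `C₂, T₁` be the constants of Titchmarsh's (9.20.7)
(`TwistedMoment.integral_norm_sq_hardyZErr_le`). For `T ≥ max(2T₁, 1)`, `P = ⌊√(T/4π)⌋` (the length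
attached to `T/2`) and EVERY real shift `u`:
`∫_T^{2T+1} |e_P(t+u)|² dt ≤ max(24 C₂, 392) · T · (2+|u|)³`. [cite: Titchmarsh1986, §9.20 eq. (9.20.7)] -/
theorem UniversalFactor.narrowUpper_err_inner_le {C₂ T₁ : ℝ} (hC₂ : 0 < C₂) (hT₁ : 2 ≤ T₁)
    (hms : ∀ T T₂ : ℝ, T₁ ≤ T → T ≤ T₂ →
      ∫ t in T..T₂, ‖TwistedMoment.hardyZErr ⌊Real.sqrt (T / (2 * π))⌋₊ t‖ ^ 2 ≤
        C₂ * (1 + (T₂ - T) / Real.sqrt T + (T₂ - T) ^ 2 / T))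
    {T : ℝ} (hT : max (2 * T₁) 1 ≤ T) (u : ℝ) :
    ∫ t in Ioc T (2 * T + 1), ‖TwistedMoment.hardyZErr ⌊Real.sqrt (T / 2 / (2 * π))⌋₊ (t + u)‖ ^ 2 ≤
      max (24 * C₂) 392 * T * (2 + |u|) ^ 3 := by
  have hT1 : 1 ≤ T := (le_max_right _ _).trans hT
  have hTT₁ : T₁ ≤ T / 2 := by have := (le_max_left _ _).trans hT; linarith
  have hT0 : 0 < T := by linarith
  set P := ⌊Real.sqrt (T / 2 / (2 * π))⌋₊ with hP
  set e := TwistedMoment.hardyZErr P with he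
  have hcont : Continuous fun s => ‖e s‖ ^ 2 := ((UniversalFactor.narrowUpper_continuous_hardyZErr P).norm).pow 2
  rw [← intervalIntegral.integral_of_le (by linarith : T ≤ 2 * T + 1),
    intervalIntegral.integral_comp_add_right (fun s => ‖e s‖ ^ 2) u]
  have h2u : (1:ℝ) ≤ 2 + |u| := by linarith [abs_nonneg u]
  have h2u3 : (1:ℝ) ≤ (2 + |u|) ^ 3 := one_le_pow₀ h2u
  rcases le_or_gt |u| (T / 2) with hu | hu
  · -- `|u| ≤ T/2`: Titchmarsh (9.20.7) on `[T/2, 5T/2 + 1]`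
    have hu' := abs_le.1 hu
    have hmono : ∫ s in (T + u)..(2 * T + 1 + u), ‖e s‖ ^ 2 ≤ ∫ s in (T / 2)..(5 * T / 2 + 1), ‖e s‖ ^ 2 :=
      intervalIntegral.integral_mono_interval (by linarith) (by linarith) (by linarith)
        (Eventually.of_forall fun s => sq_nonneg _) (hcont.intervalIntegrable _ _)
    have hlem := hms (T / 2) (5 * T / 2 + 1) hTT₁ (by linarith)
    have hnum : C₂ * (1 + (5 * T / 2 + 1 - T / 2) / Real.sqrt (T / 2) + (5 * T / 2 + 1 - T / 2) ^ 2 / (T / 2)) ≤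
        24 * C₂ * T := by
      have e1 : 5 * T / 2 + 1 - T / 2 = 2 * T + 1 := by ring
      rw [e1]
      have hs : 7 / 10 ≤ Real.sqrt (T / 2) := by
        rw [Real.le_sqrt (by norm_num) (by positivity)]; nlinarith
      have h1 : (2 * T + 1) / Real.sqrt (T / 2) ≤ 5 * T := by
        rw [div_le_iff₀ (by positivity)]; nlinarith
      have h2 : (2 * T + 1) ^ 2 / (T / 2) ≤ 18 * T := by
        rw [div_le_iff₀ (by positivity)]; nlinarith
      have h3 : 1 + (2 * T + 1) / Real.sqrt (T / 2) + (2 * T + 1) ^ 2 / (T / 2) ≤ 24 * T := by linarith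
      calc C₂ * (1 + (2 * T + 1) / Real.sqrt (T / 2) + (2 * T + 1) ^ 2 / (T / 2)) ≤ C₂ * (24 * T) :=
            mul_le_mul_of_nonneg_left h3 hC₂.le
        _ = 24 * C₂ * T := by ring
    calc ∫ s in (T + u)..(2 * T + 1 + u), ‖e s‖ ^ 2 ≤ 24 * C₂ * T := hmono.trans (hlem.trans hnum)
      _ = 24 * C₂ * T * 1 := (mul_one _).symm
      _ ≤ max (24 * C₂) 392 * T * (2 + |u|) ^ 3 := by gcongr; exact le_max_left _ _
  · -- `|u| > T/2`: crude bound, `T ≤ 2|u|`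
    have hsT : 1 ≤ Real.sqrt T := Real.one_le_sqrt.2 hT1
    have hPle : (P : ℝ) ≤ 2 * |u| := by
      have h1 : (P : ℝ) ≤ Real.sqrt (T / 2 / (2 * π)) := Nat.floor_le (Real.sqrt_nonneg _)
      have h2 : Real.sqrt (T / 2 / (2 * π)) ≤ Real.sqrt T := Real.sqrt_le_sqrt (by
        rw [div_div, div_le_iff₀ (by positivity)]; nlinarith [Real.pi_gt_three])
      have h3 : Real.sqrt T ≤ T := by nlinarith [Real.sq_sqrt hT0.le, Real.sqrt_nonneg T]
      linarith
    have hsqrtP : Real.sqrt P ≤ |u| + 1 / 2 := by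
      rw [Real.sqrt_le_left (by positivity)]; nlinarith [abs_nonneg u]
    have hsup : ∀ s ∈ Set.Icc (T + u) (2 * T + 1 + u), ‖e s‖ ^ 2 ≤ (14 * (2 + |u|)) ^ 2 := by
      intro s hs
      have hs1 : |s| ≤ 5 * |u| + 1 := by
        have h1 : |s - u| ≤ 2 * T + 1 := abs_le.2 ⟨by linarith [hs.1], by linarith [hs.2]⟩
        have h2 := abs_sub_abs_le_abs_sub s u
        linarith
      have hes := UniversalFactor.narrowUpper_norm_hardyZErr_le_crude P s
      have h3 : ‖e s‖ ≤ 14 * (2 + |u|) := by rw [he]; linarith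
      exact pow_le_pow_left₀ (norm_nonneg _) h3 2
    have hconst : ∫ s in (T + u)..(2 * T + 1 + u), ‖e s‖ ^ 2 ≤
        ∫ _ in (T + u)..(2 * T + 1 + u), (14 * (2 + |u|)) ^ 2 :=
      intervalIntegral.integral_mono_on (by linarith) (hcont.intervalIntegrable _ _)
        _root_.intervalIntegrable_const hsup
    rw [intervalIntegral.integral_const, smul_eq_mul] at hconst
    calc ∫ s in (T + u)..(2 * T + 1 + u), ‖e s‖ ^ 2 ≤ (2 * T + 1 + u - (T + u)) * (14 * (2 + |u|)) ^ 2 := hconst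
      _ = (T + 1) * 196 * (2 + |u|) ^ 2 * 1 := by ring
      _ ≤ (2 * T) * 196 * (2 + |u|) ^ 2 * (2 + |u|) := by gcongr; linarith
      _ = 392 * T * (2 + |u|) ^ 3 := by ring
      _ ≤ max (24 * C₂) 392 * T * (2 + |u|) ^ 3 := by gcongr; exact le_max_right _ _

/-- **The error term in mean square (Tonelli).** For `c > 0` there are `C_e ≥ 0`, `T_e ≥ 1` such that
for `T ≥ T_e`, with `P = ⌊√(T/4π)⌋` and `K(u) = (2+|u|)² e^{-c|u|}`: `t ↦ ∫ K(u)|e_P(t+u)|² du` is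
integrable on `(T, 2T+1]` and `∫_T^{2T+1} ∫ K(u) |e_P(t+u)|² du dt ≤ C_e (∫ (2+|u|)⁵ e^{-c|u|} du) T`.
[cite: Titchmarsh1986, §9.20 eq. (9.20.7)] -/
theorem UniversalFactor.narrowUpper_err_meanSquare {c : ℝ} (hc : 0 < c) :
    ∃ C_e T_e : ℝ, 0 ≤ C_e ∧ 1 ≤ T_e ∧ ∀ T : ℝ, T_e ≤ T →
      IntegrableOn (fun t : ℝ => ∫ u : ℝ, (2 + |u|) ^ 2 * Real.exp (-(c * |u|)) *
          ‖TwistedMoment.hardyZErr ⌊Real.sqrt (T / 2 / (2 * π))⌋₊ (t + u)‖ ^ 2) (Ioc T (2 * T + 1)) ∧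
      ∫ t in Ioc T (2 * T + 1), ∫ u : ℝ, (2 + |u|) ^ 2 * Real.exp (-(c * |u|)) *
          ‖TwistedMoment.hardyZErr ⌊Real.sqrt (T / 2 / (2 * π))⌋₊ (t + u)‖ ^ 2 ≤
        C_e * (∫ u : ℝ, (2 + |u|) ^ 5 * Real.exp (-(c * |u|))) * T := by
  obtain ⟨C₂, T₁, hC₂, hT₁, hms⟩ := TwistedMoment.integral_norm_sq_hardyZErr_le
  refine ⟨max (24 * C₂) 392, max (2 * T₁) 1, le_max_of_le_right (by norm_num), le_max_right _ _,
    fun T hT => ?_⟩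
  have hT1 : 1 ≤ T := (le_max_right _ _).trans hT
  have hT0 : 0 < T := by linarith
  set P := ⌊Real.sqrt (T / 2 / (2 * π))⌋₊ with hP
  set M := max (24 * C₂) 392 with hM
  have hF := UniversalFactor.narrowUpper_err_integrable_prod hc P T (2 * T + 1)
  have hinner : ∀ u : ℝ, ∫ t in Ioc T (2 * T + 1), ‖TwistedMoment.hardyZErr P (t + u)‖ ^ 2 ≤
      M * T * (2 + |u|) ^ 3 := fun u => UniversalFactor.narrowUpper_err_inner_le hC₂ hT₁ hms hT u
  refine ⟨hF.integral_prod_left, ?_⟩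
  have hint2 : Integrable fun u : ℝ => (M * T) * ((2 + |u|) ^ 5 * Real.exp (-(c * |u|))) :=
    (UniversalFactor.narrowUpper_integrable_pow_mul_exp hc 5).const_mul _
  calc ∫ t in Ioc T (2 * T + 1), ∫ u : ℝ, (2 + |u|) ^ 2 * Real.exp (-(c * |u|)) *
          ‖TwistedMoment.hardyZErr P (t + u)‖ ^ 2
      = ∫ u : ℝ, ∫ t in Ioc T (2 * T + 1), (2 + |u|) ^ 2 * Real.exp (-(c * |u|)) *
          ‖TwistedMoment.hardyZErr P (t + u)‖ ^ 2 := integral_integral_swap hF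
    _ = ∫ u : ℝ, (2 + |u|) ^ 2 * Real.exp (-(c * |u|)) *
          ∫ t in Ioc T (2 * T + 1), ‖TwistedMoment.hardyZErr P (t + u)‖ ^ 2 :=
        integral_congr_ae (Eventually.of_forall fun u => MeasureTheory.integral_const_mul _ _)
    _ ≤ ∫ u : ℝ, (M * T) * ((2 + |u|) ^ 5 * Real.exp (-(c * |u|))) := by
        refine integral_mono ?_ hint2 fun u => ?_
        · have hF' : Integrable fun u : ℝ => ∫ t in Ioc T (2 * T + 1), (2 + |u|) ^ 2 * Real.exp (-(c * |u|)) *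
              ‖TwistedMoment.hardyZErr P (t + u)‖ ^ 2 := hF.integral_prod_right
          exact hF'.congr (Eventually.of_forall fun u =>
            MeasureTheory.integral_const_mul ((2 + |u|) ^ 2 * Real.exp (-(c * |u|))) _)
        · have hK0 : 0 ≤ (2 + |u|) ^ 2 * Real.exp (-(c * |u|)) := by positivity
          calc (2 + |u|) ^ 2 * Real.exp (-(c * |u|)) * ∫ t in Ioc T (2 * T + 1), ‖TwistedMoment.hardyZErr P (t + u)‖ ^ 2
              ≤ (2 + |u|) ^ 2 * Real.exp (-(c * |u|)) * (M * T * (2 + |u|) ^ 3) :=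
                mul_le_mul_of_nonneg_left (hinner u) hK0
            _ = (M * T) * ((2 + |u|) ^ 5 * Real.exp (-(c * |u|))) := by ring
    _ = M * (∫ u : ℝ, (2 + |u|) ^ 5 * Real.exp (-(c * |u|))) * T := by
        rw [MeasureTheory.integral_const_mul]; ring

/-- **Registered sub-stub `narrowUpper_weighted_cs`** (verbatim signature): Cauchy–Schwarz against a majorant. [folklore] -/
theorem UniversalFactor.narrowUpper_weighted_cs : ∀ {ρ h K : ℝ → ℝ}, (∀ u : ℝ, |ρ u| ≤ K u) → MeasureTheory.Integrable K → MeasureTheory.Integrable (fun u : ℝ => K u * |h u|) → MeasureTheory.Integrable (fun u : ℝ => K u * h u ^ 2) → (∫ u : ℝ, ρ u * h u) ^ 2 ≤ (∫ u : ℝ, K u) * ∫ u : ℝ, K u * h u ^ 2 :=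
  fun hρK hK hKh hKh2 => UniversalFactor.narrowUpper_weighted_cs_of hρK hK hKh hKh2

end Summit.RiemannHypothesis.RiemannHypothesis.Theorems
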